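import Mathlib
import HarnessLib

/-!
# Negative knowledge for the crux `InertialRecession` (route EIHFluxBalance, item
stmt-FinalStateConjecture-10166): the field equations are load-bearing, and the integrability
threshold of the flux-balance mechanism is sharp

Refuter file (D-0016 negative lane, `--supports stmt-FinalStateConjecture-10166`). No Theses decl is
asserted; the content is

* `InertialRecessionWithoutFieldEquations` (the one proposition defined here) — the KINEMATIC
  SHADOW of the crux: everything its antecedent says about one modulated centre `ξ` along one axis
  (smooth, eventually inside the cone `κ² t`, speed `≤ κ² < 1`), strengthened by the decay of the
  second and third derivatives (what `C³`-closeness of the development to the modulated ansatz could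
  add without a law of motion), implies the FROZEN SHADOW of its conclusion (the lab velocity
  converges, forced by a `FinalStateDecomposition` with constant motions);
* `inertialRecession_false_without_fieldEquations : ¬ InertialRecessionWithoutFieldEquations` —
  explicit smooth witness `centre c t = c ∫₀ᵗ cos (log (1 + s²) / 2) ds`: velocity equal to `c` and to
  `-c` at arbitrarily late times, acceleration `O(1/t)`. Hence ANY proof of the crux must use the
  Einstein equations through a momentum balance with an integrable force (the route's EIH /
  Landau–Lifshitz flux law); "deviation → 0 in `C³` at no rate" freezes nothing by itself;
* `tendsto_of_integrableOn_deriv` (integrable force ⇒ the momentum converges — the freezing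
  mechanism) against `abs_deriv2_centre_le` + `not_integrable_inv` (the witness's force is `O(1/t)`,
  decaying and not integrable): the threshold is integrability, not decay.

Standing disprover's work file with the full analysis (N = 0 bookkeeping modulo push-up, route
exponent lemmas, open regimes): `Summits/FinalStateConjecture/FinalStateConjecture/Cruxes/
InertialRecession/Disproof.lean`.
-/

set_option linter.dupNamespace false

noncomputable section

namespace Summit.FinalStateConjecture.FinalStateConjecture.Theorems.InertialRecession.Negative

open Filter Set MeasureTheory intervalIntegral
open scoped Topology



/-- Slow phase `u(t) = log(1 + t²)/2 ∼ log t`. [folklore] -/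
def phase (t : ℝ) : ℝ := Real.log (1 + t ^ 2) / 2

/-- Velocity profile `v = cos ∘ u`: bounded by `1`, equal to `1` and to `-1` at arbitrarily late
times, with derivative `O(1/t)`. [folklore] -/
def vel (t : ℝ) : ℝ := Real.cos (phase t)

/-- Acceleration profile `v' = -sin(u) u'`, `u' = t/(1+t²)`. [folklore] -/
def acc (t : ℝ) : ℝ := -(Real.sin (phase t) * (t / (1 + t ^ 2)))

/-- Jerk profile `v''`. [folklore] -/
def jerk (t : ℝ) : ℝ :=
  -(Real.cos (phase t) * (t / (1 + t ^ 2)) * (t / (1 + t ^ 2)) +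
    Real.sin (phase t) * ((1 - t ^ 2) / (1 + t ^ 2) ^ 2))

/-- The witness centre `ξ_c(t) = c ∫₀ᵗ cos(u(s)) ds`. [folklore] -/
def centre (c : ℝ) (t : ℝ) : ℝ := c * ∫ s in (0 : ℝ)..t, vel s

/-- Calculus step for the witness `centre`. [folklore] -/
lemma hasDerivAt_phase (t : ℝ) : HasDerivAt phase (t / (1 + t ^ 2)) t := by
  have h1 : HasDerivAt (fun t : ℝ ↦ 1 + t ^ 2) (2 * t) t := by
    simpa using ((hasDerivAt_id' t).pow 2).const_add 1
  exact ((h1.log (by positivity : (0 : ℝ) < 1 + t ^ 2).ne').div_const 2).congr_deriv (by field_simp)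

/-- Calculus step for the witness `centre`. [folklore] -/
lemma hasDerivAt_w (t : ℝ) :
    HasDerivAt (fun t : ℝ ↦ t / (1 + t ^ 2)) ((1 - t ^ 2) / (1 + t ^ 2) ^ 2) t := by
  have h1 : HasDerivAt (fun t : ℝ ↦ 1 + t ^ 2) (2 * t) t := by
    simpa using ((hasDerivAt_id' t).pow 2).const_add 1
  exact ((hasDerivAt_id' t).div h1 (by positivity : (0 : ℝ) < 1 + t ^ 2).ne').congr_deriv (by field_simp; ring)

/-- Calculus step for the witness `centre`. [folklore] -/
lemma contDiff_phase : ContDiff ℝ ((⊤ : ℕ∞) : WithTop ℕ∞) phase :=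
  ((contDiff_const.add (contDiff_id.pow 2)).log fun t ↦ (by positivity : (0 : ℝ) < 1 + t ^ 2).ne').div_const 2

/-- Calculus step for the witness `centre`. [folklore] -/
lemma contDiff_vel : ContDiff ℝ ((⊤ : ℕ∞) : WithTop ℕ∞) vel :=
  Real.contDiff_cos.comp contDiff_phase

/-- Calculus step for the witness `centre`. [folklore] -/
lemma continuous_vel : Continuous vel := contDiff_vel.continuous

/-- Calculus step for the witness `centre`. [folklore] -/
lemma hasDerivAt_vel (t : ℝ) : HasDerivAt vel (acc t) t :=
  (hasDerivAt_phase t).cos.congr_deriv (neg_mul _ _)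

/-- Calculus step for the witness `centre`. [folklore] -/
lemma hasDerivAt_acc (t : ℝ) : HasDerivAt acc (jerk t) t := by
  have hs : HasDerivAt (fun t ↦ Real.sin (phase t)) (Real.cos (phase t) * (t / (1 + t ^ 2))) t :=
    (hasDerivAt_phase t).sin
  exact (hs.mul (hasDerivAt_w t)).neg

/-- Calculus step for the witness `centre`. [folklore] -/
lemma hasDerivAt_centre (c t : ℝ) : HasDerivAt (centre c) (c * vel t) t :=
  ((continuous_vel.integral_hasStrictDerivAt 0 t).hasDerivAt).const_mul c

/-- Calculus step for the witness `centre`. [folklore] -/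
lemma deriv_centre (c : ℝ) : deriv (centre c) = fun t ↦ c * vel t :=
  funext fun t ↦ (hasDerivAt_centre c t).deriv

/-- Calculus step for the witness `centre`. [folklore] -/
lemma deriv2_centre (c : ℝ) : deriv^[2] (centre c) = fun t ↦ c * acc t := by
  show deriv (deriv (centre c)) = _
  rw [deriv_centre]
  exact funext fun t ↦ ((hasDerivAt_vel t).const_mul c).deriv

/-- Calculus step for the witness `centre`. [folklore] -/
lemma deriv3_centre (c : ℝ) : deriv^[3] (centre c) = fun t ↦ c * jerk t := by
  show deriv (deriv^[2] (centre c)) = _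
  rw [deriv2_centre]
  exact funext fun t ↦ ((hasDerivAt_acc t).const_mul c).deriv

/-- Calculus step for the witness `centre`. [folklore] -/
lemma contDiff_centre (c : ℝ) : ContDiff ℝ ((⊤ : ℕ∞) : WithTop ℕ∞) (centre c) := by
  rw [contDiff_infty_iff_deriv, deriv_centre]
  exact ⟨fun t ↦ (hasDerivAt_centre c t).differentiableAt, contDiff_const.mul contDiff_vel⟩

/-- Calculus step for the witness `centre`. [folklore] -/
lemma abs_vel_le (t : ℝ) : |vel t| ≤ 1 := Real.abs_cos_le_one _

/-- Calculus step for the witness `centre`. [folklore] -/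
lemma abs_centre_le (c t : ℝ) : |centre c t| ≤ |c| * |t| := by
  unfold centre
  rw [abs_mul]
  refine mul_le_mul_of_nonneg_left ?_ (abs_nonneg c)
  have h := norm_integral_le_of_norm_le_const (a := 0) (b := t) (C := 1) (f := vel)
    fun x _ ↦ by simpa using abs_vel_le x
  simpa using h

/-- Calculus step for the witness `centre`. [folklore] -/
lemma w_le_inv {t : ℝ} (ht : 0 < t) : t / (1 + t ^ 2) ≤ t⁻¹ := by
  rw [div_le_iff₀ (by positivity : (0 : ℝ) < 1 + t ^ 2)]
  have : t⁻¹ * (1 + t ^ 2) = t⁻¹ + t := by field_simp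
  rw [this]
  linarith [inv_pos.mpr ht]

/-- Calculus step for the witness `centre`. [folklore] -/
lemma w_nonneg {t : ℝ} (ht : 0 < t) : 0 ≤ t / (1 + t ^ 2) := by positivity

/-- Calculus step for the witness `centre`. [folklore] -/
lemma w_le_one (t : ℝ) : t / (1 + t ^ 2) ≤ 1 := by
  rw [div_le_one (by positivity : (0 : ℝ) < 1 + t ^ 2)]
  nlinarith [sq_nonneg (t - 1)]

/-- Calculus step for the witness `centre`. [folklore] -/
lemma inv_one_add_sq_le {t : ℝ} (ht : 1 ≤ t) : (1 + t ^ 2)⁻¹ ≤ t⁻¹ := by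
  rw [inv_le_inv₀ (by positivity : (0 : ℝ) < 1 + t ^ 2) (by linarith)]
  nlinarith

/-- Calculus step for the witness `centre`. [folklore] -/
lemma abs_acc_le {t : ℝ} (ht : 0 < t) : |acc t| ≤ t⁻¹ := by
  unfold acc
  rw [abs_neg, abs_mul]
  calc |Real.sin (phase t)| * |t / (1 + t ^ 2)| ≤ 1 * t⁻¹ :=
        mul_le_mul (Real.abs_sin_le_one _) (by rw [abs_of_nonneg (w_nonneg ht)]; exact w_le_inv ht)
          (abs_nonneg _) zero_le_one
    _ = t⁻¹ := one_mul _

/-- Calculus step for the witness `centre`. [folklore] -/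
lemma abs_jerk_le {t : ℝ} (ht : 1 ≤ t) : |jerk t| ≤ 2 * t⁻¹ := by
  have ht0 : 0 < t := by linarith
  unfold jerk
  rw [abs_neg]
  refine (abs_add_le _ _).trans ?_
  have h1 : |Real.cos (phase t) * (t / (1 + t ^ 2)) * (t / (1 + t ^ 2))| ≤ t⁻¹ := by
    rw [abs_mul, abs_mul, abs_of_nonneg (w_nonneg ht0)]
    calc |Real.cos (phase t)| * (t / (1 + t ^ 2)) * (t / (1 + t ^ 2))
        ≤ 1 * 1 * t⁻¹ := by
          refine mul_le_mul (mul_le_mul (Real.abs_cos_le_one _) (w_le_one t) (w_nonneg ht0)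
            zero_le_one) (w_le_inv ht0) (w_nonneg ht0) (by positivity)
      _ = t⁻¹ := by ring
  have h2 : |Real.sin (phase t) * ((1 - t ^ 2) / (1 + t ^ 2) ^ 2)| ≤ t⁻¹ := by
    rw [abs_mul]
    have hq : |(1 - t ^ 2) / (1 + t ^ 2) ^ 2| ≤ (1 + t ^ 2)⁻¹ := by
      rw [abs_div, abs_of_pos (by positivity : (0 : ℝ) < (1 + t ^ 2) ^ 2),
        div_le_iff₀ (by positivity)]
      have : (1 + t ^ 2)⁻¹ * (1 + t ^ 2) ^ 2 = 1 + t ^ 2 := by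
        field_simp
      rw [this]
      exact (abs_sub _ _).trans (by rw [abs_one, abs_of_nonneg (sq_nonneg t)])
    calc |Real.sin (phase t)| * |(1 - t ^ 2) / (1 + t ^ 2) ^ 2| ≤ 1 * t⁻¹ :=
          mul_le_mul (Real.abs_sin_le_one _) (hq.trans (inv_one_add_sq_le ht)) (abs_nonneg _)
            zero_le_one
      _ = t⁻¹ := one_mul _
  linarith

/-- Calculus step for the witness `centre`. [folklore] -/
lemma tendsto_deriv2_centre (c : ℝ) : Tendsto (deriv^[2] (centre c)) atTop (𝓝 0) := by
  rw [deriv2_centre]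
  refine squeeze_zero_norm' ?_ ((tendsto_inv_atTop_zero.const_mul |c|).trans_eq (by simp))
  filter_upwards [eventually_gt_atTop 0] with t ht
  rw [Real.norm_eq_abs, abs_mul]
  exact mul_le_mul_of_nonneg_left (abs_acc_le ht) (abs_nonneg c)

/-- Calculus step for the witness `centre`. [folklore] -/
lemma tendsto_deriv3_centre (c : ℝ) : Tendsto (deriv^[3] (centre c)) atTop (𝓝 0) := by
  rw [deriv3_centre]
  refine squeeze_zero_norm' ?_
    ((tendsto_inv_atTop_zero.const_mul (|c| * 2)).trans_eq (by simp))
  filter_upwards [eventually_ge_atTop 1] with t ht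
  rw [Real.norm_eq_abs, abs_mul, mul_assoc]
  exact mul_le_mul_of_nonneg_left (abs_jerk_le ht) (abs_nonneg c)

/-- Calculus step for the witness `centre`. [folklore] -/
lemma vel_eq_one (n : ℕ) : vel (Real.sqrt (Real.exp (n * (2 * Real.pi) * 2) - 1)) = 1 := by
  unfold vel phase
  rw [Real.sq_sqrt (sub_nonneg.mpr (Real.one_le_exp (by positivity))), add_sub_cancel,
    Real.log_exp, mul_div_cancel_right₀ _ two_ne_zero, Real.cos_nat_mul_two_pi]

/-- Calculus step for the witness `centre`. [folklore] -/
lemma vel_eq_neg_one (n : ℕ) :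
    vel (Real.sqrt (Real.exp ((n * (2 * Real.pi) + Real.pi) * 2) - 1)) = -1 := by
  unfold vel phase
  rw [Real.sq_sqrt (sub_nonneg.mpr (Real.one_le_exp (by positivity))), add_sub_cancel,
    Real.log_exp, mul_div_cancel_right₀ _ two_ne_zero, Real.cos_nat_mul_two_pi_add_pi]

/-- Calculus step for the witness `centre`. [folklore] -/
lemma le_sqrt_exp_sub_one {a x : ℝ} (hx : a ^ 2 + 1 ≤ x) : a ≤ Real.sqrt (Real.exp x - 1) := by
  rcases le_or_gt a 0 with ha | ha
  · exact ha.trans (Real.sqrt_nonneg _)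
  · rw [Real.le_sqrt' ha]
    linarith [Real.add_one_le_exp x]

/-- Calculus step for the witness `centre`. [folklore] -/
lemma frequently_vel_eq_one : ∃ᶠ t in atTop, vel t = 1 := by
  rw [frequently_atTop]
  intro a
  obtain ⟨n, hn⟩ := exists_nat_ge (a ^ 2 + 1)
  refine ⟨_, le_sqrt_exp_sub_one ?_, vel_eq_one n⟩
  nlinarith [Real.pi_gt_three]

/-- Calculus step for the witness `centre`. [folklore] -/
lemma frequently_vel_eq_neg_one : ∃ᶠ t in atTop, vel t = -1 := by
  rw [frequently_atTop]
  intro a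
  obtain ⟨n, hn⟩ := exists_nat_ge (a ^ 2 + 1)
  refine ⟨_, le_sqrt_exp_sub_one ?_, vel_eq_neg_one n⟩
  nlinarith [Real.pi_gt_three]

/-- Calculus step for the witness `centre`. [folklore] -/
theorem not_tendsto_deriv_centre {c : ℝ} (hc : c ≠ 0) :
    ¬ ∃ v : ℝ, Tendsto (deriv (centre c)) atTop (𝓝 v) := by
  rintro ⟨v, hv⟩
  rw [deriv_centre] at hv
  have h1 : v = c * 1 := tendsto_nhds_unique_of_frequently_eq hv tendsto_const_nhds
    (frequently_vel_eq_one.mono fun t ht ↦ by rw [ht])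
  have h2 : v = c * (-1) := tendsto_nhds_unique_of_frequently_eq hv tendsto_const_nhds
    (frequently_vel_eq_neg_one.mono fun t ht ↦ by rw [ht])
  exact hc (by linarith)


/-- `InertialRecession` with the field equations (MGHD, `Ric = 0`, hence any flux balance) DROPPED and
only the kinematics of the moduli kept. Antecedent = the KINEMATIC SHADOW of the crux for one centre
`ξ` along one axis (every clause of the crux's antecedent about the moduli — `C^∞`, eventually inside
the cone `κ² t`, `0 < κ < 1`, speed `≤ κ²` — strengthened by the decay of the second and third
derivatives); conclusion = the FROZEN SHADOW (the lab velocity converges, as forced by a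
`FinalStateDecomposition` with constant motions). Refuted below.
[topic: Summits/FinalStateConjecture/FinalStateConjecture — multi-black-hole kinematics, crux InertialRecession] -/
def InertialRecessionWithoutFieldEquations : Prop :=
  ∀ (κ : ℝ) (ξ : ℝ → ℝ), ContDiff ℝ ((⊤ : ℕ∞) : WithTop ℕ∞) ξ → 0 < κ → κ < 1 →
    (∀ᶠ t in atTop, |ξ t| ≤ κ ^ 2 * t) → (∀ t, |deriv ξ t| ≤ κ ^ 2) →
      Tendsto (deriv^[2] ξ) atTop (𝓝 0) → Tendsto (deriv^[3] ξ) atTop (𝓝 0) →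
        ∃ v : ℝ, Tendsto (deriv ξ) atTop (𝓝 v)

/-- The witness is eventually inside the cone `κ² t` with `κ = 1/2` (`c = κ² = 1/4`). [folklore] -/
theorem eventually_abs_centre_le : ∀ᶠ t in atTop, |centre (1 / 4) t| ≤ (1 / 2) ^ 2 * t := by
  filter_upwards [eventually_ge_atTop 0] with t ht
  calc |centre (1 / 4) t| ≤ |(1 / 4 : ℝ)| * |t| := abs_centre_le _ _
    _ = (1 / 2) ^ 2 * t := by rw [abs_of_nonneg ht]; norm_num

/-- The witness has speed `≤ κ²`, `κ = 1/2`. [folklore] -/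
theorem abs_deriv_centre_le (t : ℝ) : |deriv (centre (1 / 4)) t| ≤ (1 / 2) ^ 2 := by
  rw [deriv_centre, abs_mul]
  calc |(1 / 4 : ℝ)| * |vel t| ≤ |(1 / 4 : ℝ)| * 1 :=
      mul_le_mul_of_nonneg_left (abs_vel_le t) (abs_nonneg _)
    _ = (1 / 2) ^ 2 := by norm_num

/-- **Any proof of `InertialRecession` must use the field equations**: the kinematic shadow does
not freeze the velocity (witness `centre (1/4)`, velocity `cos(log(1+t²)/2)/4`, equal to `± 1/4` at
arbitrarily late times, acceleration `O(1/t)`). [folklore] -/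
theorem inertialRecession_false_without_fieldEquations : ¬ InertialRecessionWithoutFieldEquations :=
  fun h ↦ not_tendsto_deriv_centre (by norm_num : (1 / 4 : ℝ) ≠ 0)
    (h (1 / 2) _ (contDiff_centre _) (by norm_num) (by norm_num) eventually_abs_centre_le
      abs_deriv_centre_le (tendsto_deriv2_centre _) (tendsto_deriv3_centre _))

/-- THE FREEZING MECHANISM (what the route's flux law must deliver): a momentum `P` with `P' = F`
on `[t₀, ∞)` and `F` integrable there converges, to `P t₀ + ∫_{t₀}^∞ F`. [folklore] -/
theorem tendsto_of_integrableOn_deriv {P F : ℝ → ℝ} {t₀ : ℝ}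
    (hP : ∀ t, t₀ ≤ t → HasDerivAt P (F t) t) (hF : IntegrableOn F (Ioi t₀)) :
    Tendsto P atTop (𝓝 (P t₀ + ∫ t in Ioi t₀, F t)) := by
  have key : ∀ b, t₀ ≤ b → P b = P t₀ + ∫ t in t₀..b, F t := by
    intro b hb
    have hderiv : ∀ x ∈ uIcc t₀ b, HasDerivAt P (F x) x := fun x hx ↦ by
      rw [uIcc_of_le hb] at hx
      exact hP x hx.1
    have hint : IntervalIntegrable F volume t₀ b :=
      intervalIntegrable_iff.mpr (hF.mono_set (by rw [uIoc_of_le hb]; exact Ioc_subset_Ioi_self))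
    rw [integral_eq_sub_of_hasDerivAt hderiv hint]
    ring
  have h2 : Tendsto (fun b ↦ P t₀ + ∫ t in t₀..b, F t) atTop (𝓝 (P t₀ + ∫ t in Ioi t₀, F t)) :=
    (intervalIntegral_tendsto_integral_Ioi t₀ hF tendsto_id).const_add _
  refine h2.congr' ?_
  filter_upwards [eventually_ge_atTop t₀] with b hb
  exact (key b hb).symm

/-- TIGHTNESS: the witness is driven by a force of size `O(1/t)` — `|ξ''(t)| ≤ |c|/t` for `t > 0` —
decaying, but (`not_integrable_inv`) not integrable. [folklore] -/
theorem abs_deriv2_centre_le (c : ℝ) {t : ℝ} (ht : 0 < t) :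
    |deriv^[2] (centre c) t| ≤ |c| * t⁻¹ := by
  rw [deriv2_centre, abs_mul]
  exact mul_le_mul_of_nonneg_left (abs_acc_le ht) (abs_nonneg c)

/-- `t⁻¹` is not integrable on `(1, ∞)`: the integrability threshold of the freezing mechanism is
sharp (decay of the force is not enough). [folklore] -/
theorem not_integrable_inv : ¬ IntegrableOn (fun t : ℝ ↦ t ^ (-1 : ℝ)) (Ioi 1) := fun h ↦ by
  have := (integrableOn_Ioi_rpow_iff zero_lt_one).mp h
  norm_num at this

end Summit.FinalStateConjecture.FinalStateConjecture.Theorems.InertialRecession.Negative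

end
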